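import Literature.Algebra.EuclideanLattices.GaussianRoundingConvolution
import Literature.Algebra.EuclideanLattices.GaussianCosetSmoothing
import Literature.Computability.Cryptography.StatisticalDistance
import HarnessLib

/-!
# The law of a Gaussian rounding `x + D_{L-x,s}`, `x ← D_r`, as a probability mass function on `L`, within `2ε` of `D_{L,√(r²+s²)}` (BLPRS 2013, Lemma 2.10, sampled form)

Topic `Algebra/EuclideanLattices` (family `pqc`). Packaging of the tree's density-style
**BLPRS 2013, Lemma 2.10 = Peikert 2010, Thm. 3.1 (special case)** (`GaussianRoundingConvolution.lean`:
`P(λ) = ∫ ρ_r(x)/rⁿ · D_{L,s,x}(λ) dx` satisfies `∑_λ |P(λ) - D_{L,t}(λ)| ≤ 4ε`) as a statement about the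
LAW of the sampled lattice point, for consumers that run the two-stage sampling — the Gaussian randomised
rounding of BLPRS Lemma 3.5 (`ModulusSwitchCore.lean`) and the step of **Lemma 4.7** (pqc.S21,
`Literature.Computability.Cryptography.blprs_gapSVP_sqrt_dim_to_lwe_classical`):

> *"It also chooses `c` from `D_{q⁻¹ℤᵐ - b', r}` … by Lemma 2.10 … the distribution of `Ue + f + c` is
> within statistical distance `8ε` of `D_{q⁻¹ℤᵐ,(α²ξ²+r²)^{1/2}}`"* (arXiv:1306.0281, proof of Lemma 4.7),
> with `Ue + f ∼ D_{αξ}` spherical (`ContinuousGaussianMultivariate.lean`).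

Proved (no named fact): the two-stage sampling `x ← D_r` (the tree's `continuousGaussian E r`), then
`λ ← D_{L,s,x}` (the tree's `discreteGaussian L s x`, i.e. `λ = x + y`, `y ← D_{L-x,s}`) produces the
probability mass function `roundingLaw L r s` on `L` with `Pr[λ] = ∫ D_{L,s,x}(λ) dD_r(x) = P(λ)`, and
`Δ(roundingLaw, D_{L,t}) ≤ 2ε ≤ 8ε` for `s ≥ η_ε(L)`, `0 < ε ≤ 1/2`.

## Results

* `measurable_discreteGaussian_apply`, `roundingMass`, `tsum_roundingMass` (`= 1`, Tonelli),
  **`roundingLaw L hr hs : PMF L`**, `toReal_roundingLaw_apply` (`= P(λ)` of the density file);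
* **`tvDist_roundingLaw_discreteGaussian_le`** — `Δ(roundingLaw L r s, D_{L,√(r²+s²)}) ≤ 2ε`
  (and `…_le_eight` with the printed `8ε`).

## References

* Z. Brakerski, A. Langlois, C. Peikert, O. Regev, D. Stehlé, *Classical hardness of learning with errors*,
  STOC 2013; arXiv:1306.0281, Lemma 2.10 and the proof of Lemma 4.7.
* C. Peikert, *An efficient and parallel Gaussian sampler for lattices*, CRYPTO 2010, Thm. 3.1.
-/

noncomputable section

open MeasureTheory Module
open scoped Real ENNReal InnerProductSpace

namespace Literature.Algebra.EuclideanLattices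

variable {E : Type*} [NormedAddCommGroup E] [InnerProductSpace ℝ E] [FiniteDimensional ℝ E]
  [MeasurableSpace E] [BorelSpace E]
variable (L : Submodule ℤ E) [DiscreteTopology L] [IsZLattice ℝ L]

/-- Measurability of the rounding weight `x ↦ D_{L,s,x}(λ)` in `ℝ≥0∞` (from the tree's real-valued
version). [folklore] -/
theorem measurable_discreteGaussian_apply {s : ℝ} (hs : 0 < s) (lam : L) :
    Measurable fun x : E => discreteGaussian L s x lam := by
  have h : (fun x : E => discreteGaussian L s x lam) =
      fun x => ENNReal.ofReal ((discreteGaussian L s x lam).toReal) := by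
    funext x; rw [ENNReal.ofReal_toReal (PMF.apply_ne_top _ _)]
  rw [h]
  exact (measurable_toReal_discreteGaussian_apply L hs lam).ennreal_ofReal

/-- The mass at `λ` of the Gaussian rounding: `E_{x ← D_r}[D_{L,s,x}(λ)]`. [cite: BrakerskiEtAl2013, Lemma 2.10] -/
def roundingMass (r s : ℝ) (lam : L) : ℝ≥0∞ :=
  ∫⁻ x, discreteGaussian L s x lam ∂(continuousGaussian E r)

/-- The masses sum to `1` (Tonelli: `∑_λ D_{L,s,x}(λ) = 1` for every `x`, and `D_r` is a probability
measure). [folklore] -/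
theorem tsum_roundingMass {r s : ℝ} (hr : 0 < r) (hs : 0 < s) : ∑' lam : L, roundingMass L r s lam = 1 := by
  haveI := isProbabilityMeasure_continuousGaussian (E := E) hr
  unfold roundingMass
  rw [← lintegral_tsum fun lam => (measurable_discreteGaussian_apply L hs lam).aemeasurable]
  simp_rw [PMF.tsum_coe]
  rw [lintegral_const, one_mul, measure_univ]

/-- **The law of the Gaussian rounding** `λ = x + y`, `x ← D_r`, `y ← D_{L-x,s}` (equivalently
`λ ← D_{L,s,x}`), as a probability mass function on `L`. [cite: BrakerskiEtAl2013, Lemma 2.10] -/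
def roundingLaw {r s : ℝ} (hr : 0 < r) (hs : 0 < s) : PMF L :=
  ⟨roundingMass L r s, ENNReal.summable.hasSum_iff.2 (tsum_roundingMass L hr hs)⟩

/-- Unfolding. [folklore] -/
theorem roundingLaw_apply {r s : ℝ} (hr : 0 < r) (hs : 0 < s) (lam : L) :
    roundingLaw L hr hs lam = ∫⁻ x, discreteGaussian L s x lam ∂(continuousGaussian E r) := rfl

/-- **`Pr[λ] = P(λ)`**: the mass of the rounding law is the density-file quantity
`∫ ρ_r(x)/rⁿ · D_{L,s,x}(λ) dx`. [cite: BrakerskiEtAl2013, Lemma 2.10] -/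
theorem toReal_roundingLaw_apply {r s : ℝ} (hr : 0 < r) (hs : 0 < s) (lam : L) :
    (roundingLaw L hr hs lam).toReal =
      ∫ x : E, gaussianFunction r x / r ^ finrank ℝ E * (discreteGaussian L s x lam).toReal := by
  have hdens : Measurable fun x : E => ENNReal.ofReal (gaussianFunction r x / r ^ finrank ℝ E) := by
    refine Measurable.ennreal_ofReal (Measurable.div_const (Continuous.measurable ?_) _)
    unfold gaussianFunction; fun_prop
  have hD := measurable_discreteGaussian_apply L hs lam
  rw [roundingLaw_apply, continuousGaussian, lintegral_withDensity_eq_lintegral_mul _ hdens hD]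
  -- the right-hand side as a lintegral of a nonnegative function
  have hnn : 0 ≤ᵐ[volume] fun x : E => gaussianFunction r x / r ^ finrank ℝ E * (discreteGaussian L s x lam).toReal :=
    ae_of_all _ fun x => mul_nonneg (div_nonneg (gaussianFunction_pos _ _).le (pow_nonneg hr.le _))
      ENNReal.toReal_nonneg
  have hmeas : AEStronglyMeasurable
      (fun x : E => gaussianFunction r x / r ^ finrank ℝ E * (discreteGaussian L s x lam).toReal) volume := by
    refine (Measurable.mul (Measurable.div_const (Continuous.measurable ?_) _)
      (measurable_toReal_discreteGaussian_apply L hs lam)).aestronglyMeasurable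
    unfold gaussianFunction; fun_prop
  rw [integral_eq_lintegral_of_nonneg_ae hnn hmeas]
  congr 1
  refine lintegral_congr fun x => ?_
  simp only [Pi.mul_apply]
  rw [ENNReal.ofReal_mul (div_nonneg (gaussianFunction_pos _ _).le (pow_nonneg hr.le _)),
    ENNReal.ofReal_toReal (PMF.apply_ne_top _ _)]

/-- **BLPRS 2013, Lemma 2.10, sampled form**: for `0 < ε ≤ 1/2`, `0 < r, s`, `s ≥ η_ε(L)`, the law of the
Gaussian rounding is within statistical distance `2ε` of the discrete Gaussian `D_{L,√(r²+s²)}`.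
[cite: BrakerskiEtAl2013, Lemma 2.10] -/
theorem tvDist_roundingLaw_discreteGaussian_le {ε r s : ℝ} (hε : 0 < ε) (hε' : ε ≤ 1 / 2) (hr : 0 < r)
    (hs : 0 < s) (hη : smoothingParameter L ε ≤ s) :
    (roundingLaw L hr hs).tvDist (discreteGaussian L (Real.sqrt (r ^ 2 + s ^ 2)) 0) ≤ 2 * ε := by
  have h := Peikert2010.tsum_abs_integral_mul_discreteGaussian_sub_le L hε hε' hr hs hη
  rw [PMF.tvDist]
  simp_rw [toReal_roundingLaw_apply]
  linarith

/-- The printed constant: `Δ ≤ 8ε`. [cite: BrakerskiEtAl2013, Lemma 2.10] -/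
theorem tvDist_roundingLaw_discreteGaussian_le_eight {ε r s : ℝ} (hε : 0 < ε) (hε' : ε ≤ 1 / 2) (hr : 0 < r)
    (hs : 0 < s) (hη : smoothingParameter L ε ≤ s) :
    (roundingLaw L hr hs).tvDist (discreteGaussian L (Real.sqrt (r ^ 2 + s ^ 2)) 0) ≤ 8 * ε :=
  (tvDist_roundingLaw_discreteGaussian_le L hε hε' hr hs hη).trans (by linarith)

end Literature.Algebra.EuclideanLattices

end
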